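import Mathlib
import HarnessLib
import Literature.Analysis.FluidPDE.TypeIAncientMild
import Summits.NavierStokesRegularity.NavierStokesRegularity.Theorems.QuarterLogPincerQuietCollarDefsLog
import Summits.NavierStokesRegularity.NavierStokesRegularity.Theorems.QuarterLogPincerQuietCollarCutReference
import Summits.NavierStokesRegularity.NavierStokesRegularity.Theorems.QuarterLogPincerQuietCollarCutPairData
import Summits.NavierStokesRegularity.NavierStokesRegularity.Theorems.QuarterLogPincerQuietCollarCutPairDefect

/-!
# Route `QuarterLogPincer`, crux `TypeIQuantSubcubicExp` (stmt-NavierStokesRegularity-24077), line `quiet_collar` —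
# QP2 IN THE LOG-WEIGHTED TYPING, CLOSED: `stub_cutPairLog : StubCutPairLog`

The cut pair of ns-idea-7's LOOP line `quiet_collar`, in the log-weighted typing of the pub-ns-dss typer's audit
(`Theorems/QuarterLogPincerQuietCollarDefsLog.lean`; DIRECTOR-NS KEY-NS #187/#188): for a Type-I ancient mild field `v` with the
log-shaped cube budget (the budget is not even used — it only enters QP2 through the hypothesis `b` of the `L³` clause), every
sup tolerance `η₁εⁿ` and every log-quiet collar `{r ≤ |x| ≤ r+Lq}` (`‖v‖ ≤ ηq/(1+log r)` there for `s ∈ [−1,−ε]`), the REFERENCE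
`V(t) = χ·v(t−1)` (`χ = radialCutoff r (r+Lq)`) and the DATUM `u₀` of module D satisfy the twelve clauses of `CutPairLog`.

Constants (given `M`, `η₁`, `n`, and the absolute constants `C_D, C_R` of module D, `C_E` of module E):
`Lq = K_L·ε^{−(2n+2)}` with `K_L = 4C_E(M+1)/η₁ + (4C_E(M²+1)/η₁)² + 1` (kills the heat commutator `C_E M/Lq` and the Oseen
commutator `C_E(M²/ε)Lq^{−1/2}`), `ηq = εⁿ/K_η` with `K_η = 4(C_D + C_E)/η₁ + 1` (kills the data error `C_D ηq` and the
transition term `C_E η_c²`), radius factor `Λ = ε⁻¹`, `R = 2Λ(r+Lq)²`, exponents `k₂ = 4n+5`,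
`K₂ = K_η + K_L + 4(1+K_L²) + (C_R + C_D) + C_E(M²+2M+2) + 1`.

* `stub_cutPairLog : StubCutPairLog` — QP2-log PROVED.  With `stub_quietCollarLog` (QP1-log, `…QuietCollarLeverLog`) and
  `stub_forcedTwoNormShadowing` (QP3, `…QuietCollarShadowing`) every registered piece of the line's edge Q1 is a tree theorem by
  name in the log-weighted typing; rebasing the line's registered QP1/QP2 and its composition onto the `…Log` objects is the
  author's (ns-idea-7) step and is NOT done here.

HONEST FRAME: a statement about HYPOTHETICAL Type-I ancient mild fields; the loop line identifies 24077 with a log-cube Liouville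
statement and attacks no wall; 24077, 22144, W7 and Navier–Stokes regularity are OPEN / not proved.  pub-ns-dss typer (g37),
`--supports stmt-NavierStokesRegularity-24077`.
-/

noncomputable section

set_option linter.dupNamespace false

namespace Summit.NavierStokesRegularity.NavierStokesRegularity.Cruxes.TypeIQuantSubcubicExp.QuietCollar

open MeasureTheory Set Function Filter Real Metric
open scoped ENNReal NNReal Topology
open Literature.Analysis Literature.Analysis.FluidPDE

/-! ### ε-arithmetic of the constants -/

/-- For `0 < ε ≤ 1` and `b ≤ a`: `ε^a ≤ ε^b`. [folklore] -/
theorem eps_rpow_le_rpow {ε a b : ℝ} (hε : 0 < ε) (hε1 : ε ≤ 1) (hab : b ≤ a) : ε ^ a ≤ ε ^ b :=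
  Real.rpow_le_rpow_of_exponent_ge hε hε1 hab

/-- The collar width `Lq = K_L ε^{−(2n+2)}`: `1 ≤ Lq`, `M/Lq ≤ M εⁿ/K_L`, `(M²/ε)·Lq^{−1/2} ≤ M² εⁿ K_L^{−1/2}`. [folklore] -/
theorem collarWidth_facts {ε n KL M : ℝ} (hε : 0 < ε) (hε1 : ε ≤ 1) (hn : 0 ≤ n) (hKL : 1 ≤ KL) (hM : 0 ≤ M) :
    1 ≤ KL * ε ^ (-(2 * n + 2)) ∧
    M / (KL * ε ^ (-(2 * n + 2))) ≤ M * ε ^ n / KL ∧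
    M ^ 2 / ε * (KL * ε ^ (-(2 * n + 2))) ^ (-(1 / 2 : ℝ)) ≤ M ^ 2 * ε ^ n * KL ^ (-(1 / 2 : ℝ)) := by
  have hKL0 : 0 < KL := by linarith
  have he1 : 1 ≤ ε ^ (-(2 * n + 2)) := Real.one_le_rpow_of_pos_of_le_one_of_nonpos hε hε1 (by linarith)
  refine ⟨?_, ?_, ?_⟩
  · nlinarith
  · rw [Real.rpow_neg hε.le, ← div_eq_mul_inv, div_div_eq_mul_div]
    rw [div_le_div_iff_of_pos_right hKL0]
    have : ε ^ (2 * n + 2) ≤ ε ^ n := eps_rpow_le_rpow hε hε1 (by linarith)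
    exact mul_le_mul_of_nonneg_left this hM
  · rw [Real.mul_rpow hKL0.le (Real.rpow_nonneg hε.le _), ← Real.rpow_mul hε.le]
    have hexp : -(2 * n + 2) * -(1 / 2 : ℝ) = n + 1 := by ring
    rw [hexp]
    have h1 : M ^ 2 / ε * (KL ^ (-(1 / 2 : ℝ)) * ε ^ (n + 1)) = M ^ 2 * ε ^ n * KL ^ (-(1 / 2 : ℝ)) := by
      rw [Real.rpow_add hε, Real.rpow_one]
      field_simp
    rw [h1]

/-- The radius bound: `2ε⁻¹(r+Lq)² ≤ 4(1+K_L²)·ε^{−(4n+5)}·r²` for `r ≥ 1`. [folklore] -/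
theorem radius_le {ε n KL r : ℝ} (hε : 0 < ε) (hε1 : ε ≤ 1) (hn : 0 ≤ n) (hKL : 1 ≤ KL) (hr : 1 ≤ r) :
    2 * (ε⁻¹ * (r + KL * ε ^ (-(2 * n + 2))) ^ 2) ≤ 4 * (1 + KL ^ 2) * ε ^ (-(4 * n + 5)) * (r * r) := by
  have hKL0 : 0 < KL := by linarith
  set E : ℝ := ε ^ (-(2 * n + 2)) with hE
  have hE1 : 1 ≤ E := Real.one_le_rpow_of_pos_of_le_one_of_nonpos hε hε1 (by linarith)
  have hsq : ε⁻¹ * E ^ 2 = ε ^ (-(4 * n + 5)) := by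
    rw [hE, ← Real.rpow_natCast, ← Real.rpow_mul hε.le, ← Real.rpow_neg_one, ← Real.rpow_add hε]
    norm_num; ring_nf
  have hε5 : ε⁻¹ ≤ ε ^ (-(4 * n + 5)) := by
    rw [← Real.rpow_neg_one]; exact eps_rpow_le_rpow hε hε1 (by linarith)
  have hεinv : 0 < ε⁻¹ := inv_pos.2 hε
  have h1 : (r + KL * E) ^ 2 ≤ 2 * r ^ 2 + 2 * (KL * E) ^ 2 := by nlinarith [sq_nonneg (r - KL * E)]
  have hr2 : 1 ≤ r * r := by nlinarith
  calc 2 * (ε⁻¹ * (r + KL * E) ^ 2) ≤ 2 * (ε⁻¹ * (2 * r ^ 2 + 2 * (KL * E) ^ 2)) := by gcongr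
    _ = 4 * ε⁻¹ * (r * r) + 4 * KL ^ 2 * (ε⁻¹ * E ^ 2) := by ring
    _ = 4 * ε⁻¹ * (r * r) + 4 * KL ^ 2 * ε ^ (-(4 * n + 5)) := by rw [hsq]
    _ ≤ 4 * ε ^ (-(4 * n + 5)) * (r * r) + 4 * KL ^ 2 * ε ^ (-(4 * n + 5)) * (r * r) := by
        have h0 : 0 ≤ 4 * KL ^ 2 * ε ^ (-(4 * n + 5)) := by positivity
        nlinarith [mul_le_mul_of_nonneg_right hε5 (by positivity : (0:ℝ) ≤ 4 * (r * r))]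
    _ = 4 * (1 + KL ^ 2) * ε ^ (-(4 * n + 5)) * (r * r) := by ring

/-! ### QP2 in the log-weighted typing -/

set_option maxHeartbeats 1600000 in
/-- **QP2-log PROVED**: `StubCutPairLog` — for every Type-I ancient mild field with the log-shaped cube budget, the cut pair
`(V = χ·v(·−1), u₀)` with the constants of the module docstring satisfies `CutPairLog v` (reference clauses:
`…QuietCollarCutReference`; datum: `exists_cutPair_datum`; defect: `exists_mildDefect_cutRef_bounds`). [folklore] -/
theorem stub_cutPairLog : StubCutPairLog := by
  intro M v hv _hB η₁ n hη₁ hn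
  obtain ⟨CD, CR, hCD, hdatum⟩ := exists_cutPair_datum
  obtain ⟨CE, hCE, hdefect⟩ := exists_mildDefect_cutRef_bounds
  have hM : 0 ≤ M := hv.nonneg
  -- the constants
  set KL : ℝ := 4 * CE * (M + 1) / η₁ + (4 * CE * (M ^ 2 + 1) / η₁) ^ 2 + 1 with hKL
  have hKL1 : 1 ≤ KL := by
    rw [hKL]; have : 0 ≤ 4 * CE * (M + 1) / η₁ := (by positivity); nlinarith [sq_nonneg (4 * CE * (M ^ 2 + 1) / η₁)]
  have hKL0 : 0 < KL := by linarith
  set Kη : ℝ := 4 * (CD + CE) / η₁ + 1 with hKη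
  have hKη1 : 1 ≤ Kη := by rw [hKη]; have : 0 ≤ 4 * (CD + CE) / η₁ := (by positivity); linarith
  have hKη0 : 0 < Kη := by linarith
  set K₂ : ℝ := Kη + KL + 4 * (1 + KL ^ 2) + ((CR : ℝ) + CD) + CE * (M ^ 2 + 2 * M + 2) + 1 with hK₂
  have hCR0 : 0 ≤ (CR : ℝ) := CR.coe_nonneg
  have hK₂η : Kη ≤ K₂ := by rw [hK₂]; nlinarith [sq_nonneg KL]
  have hK₂L : KL ≤ K₂ := by rw [hK₂]; nlinarith [sq_nonneg KL]
  have hK₂R : 4 * (1 + KL ^ 2) ≤ K₂ := by rw [hK₂]; nlinarith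
  have hK₂D : (CR : ℝ) + CD ≤ K₂ := by rw [hK₂]; nlinarith [sq_nonneg KL]
  have hK₂E : CE * (M ^ 2 + 2 * M + 2) ≤ K₂ := by rw [hK₂]; nlinarith [sq_nonneg KL]
  have hK₂1 : 1 ≤ K₂ := le_trans hKη1 hK₂η
  refine ⟨4 * n + 5, K₂, by linarith, hK₂1, ?_⟩
  intro ε hε
  have hεpos : 0 < ε := hε.1
  have hε1 : ε ≤ 1 := by linarith [hε.2]
  have hεn : ε ^ n ≤ 1 := Real.rpow_le_one hεpos.le hε1 hn
  have hεn0 : 0 < ε ^ n := Real.rpow_pos_of_pos hεpos _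
  -- the requests
  set ηq : ℝ := ε ^ n / Kη with hηq
  set Lq : ℝ := KL * ε ^ (-(2 * n + 2)) with hLq
  obtain ⟨hLq1, hML, hML2⟩ := collarWidth_facts (M := M) hεpos hε1 hn hKL1 hM
  have hLq0 : 0 < Lq := by rw [hLq]; linarith
  have hηq0 : 0 < ηq := by positivity
  have hηq1 : ηq ≤ 1 := by
    rw [hηq, div_le_one hKη0]; exact hεn.trans hKη1
  refine ⟨ηq, Lq, ?_, hLq0, ?_, ?_⟩
  · -- `ε^{k₂}/K₂ ≤ ηq`
    rw [hηq]
    have h1 : ε ^ (4 * n + 5) ≤ ε ^ n := eps_rpow_le_rpow hεpos hε1 (by linarith)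
    calc ε ^ (4 * n + 5) / K₂ ≤ ε ^ n / K₂ := div_le_div_of_nonneg_right h1 (by linarith)
      _ ≤ ε ^ n / Kη := div_le_div_of_nonneg_left hεn0.le hKη0 hK₂η
  · -- `Lq ≤ K₂ ε^{−k₂}`
    rw [hLq]
    have h1 : ε ^ (-(2 * n + 2)) ≤ ε ^ (-(4 * n + 5)) := eps_rpow_le_rpow hεpos hε1 (by linarith)
    calc KL * ε ^ (-(2 * n + 2)) ≤ KL * ε ^ (-(4 * n + 5)) := mul_le_mul_of_nonneg_left h1 hKL0.le
      _ ≤ K₂ * ε ^ (-(4 * n + 5)) := mul_le_mul_of_nonneg_right hK₂L (Real.rpow_nonneg hεpos.le _)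
  -- the collar
  intro r hr2 hquiet
  have hr0 : 0 < r := by linarith
  have hr1 : 1 ≤ r := by linarith
  have hlog : 0 ≤ Real.log r := Real.log_nonneg (by linarith)
  have hlog1 : 1 ≤ 1 + Real.log r := by linarith
  set ηc : ℝ := ηq / (1 + Real.log r) with hηc
  have hηc0 : 0 ≤ ηc := by positivity
  have hηcq : ηc ≤ ηq := div_le_self hηq0.le hlog1
  set Λ : ℝ := ε⁻¹ with hΛ
  have hΛ1 : 1 ≤ Λ := by rw [hΛ]; exact one_le_inv_iff₀.2 ⟨hεpos, hε1⟩
  set R : ℝ := 2 * (Λ * (r + Lq) ^ 2) with hR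
  have hrLq : 0 < r + Lq := by linarith
  have hRge : r + Lq ≤ R := by
    rw [hR]
    have h1 : r + Lq ≤ (r + Lq) ^ 2 := by nlinarith
    have h2 : (r + Lq) ^ 2 ≤ Λ * (r + Lq) ^ 2 := by nlinarith
    linarith
  have hrR : r < R := by linarith
  -- the datum (module D) with `a = v(−1)`, level `ηc`, radius factor `Λ`
  have ha : ContDiff ℝ (⊤ : ℕ∞) (v (-1)) := hv.contDiff_slice (by norm_num)
  have hadiv : VectorCalculus.IsDivFree (v (-1)) := hv.isDivFree (by norm_num)
  have hquiet1 : ∀ t : EuclideanSpace ℝ (Fin 3), r ≤ ‖t‖ → ‖t‖ ≤ r + Lq → ‖v (-1) t‖ ≤ ηc := fun t h1 h2 =>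
    hquiet (-1) ⟨le_rfl, by linarith [hε.2]⟩ t h1 h2
  obtain ⟨u₀, hu₀s, hu₀d, hu₀c, hu₀supp, hu₀sup, hu₀L3⟩ := hdatum (v (-1)) r Lq ηc Λ ha hadiv hr2 hLq1 hηc0 hΛ1 hquiet1
  -- the defect (module E)
  have hdef : ∀ b : ℝ, 0 ≤ b → _ := fun b hb => hdefect M v hv r Lq ε Λ ηc b hr0.le hLq1 hε hΛ1 hηc0 hb
  -- smallness bookkeeping: `C_D ηq ≤ η₁εⁿ/4`, `C_E ηq ≤ η₁εⁿ/4`, `C_E M/Lq ≤ η₁εⁿ/4`, `C_E (M²/ε)Lq^{-1/2} ≤ η₁εⁿ/4`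
  have hsmall_D : CD * ηq ≤ η₁ * ε ^ n / 4 := by
    rw [hηq]
    have h1 : CD ≤ Kη * η₁ / 4 := by
      rw [hKη]
      have : (4 * (CD + CE) / η₁ + 1) * η₁ / 4 = CD + CE + η₁ / 4 := by field_simp
      rw [this]; linarith
    calc CD * (ε ^ n / Kη) = CD / Kη * ε ^ n := by ring
      _ ≤ (Kη * η₁ / 4) / Kη * ε ^ n := by gcongr
      _ = η₁ * ε ^ n / 4 := by field_simp
  have hsmall_Eη : CE * ηq ≤ η₁ * ε ^ n / 4 := by
    rw [hηq]
    have h1 : CE ≤ Kη * η₁ / 4 := by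
      rw [hKη]
      have : (4 * (CD + CE) / η₁ + 1) * η₁ / 4 = CD + CE + η₁ / 4 := by field_simp
      rw [this]; linarith
    calc CE * (ε ^ n / Kη) = CE / Kη * ε ^ n := by ring
      _ ≤ (Kη * η₁ / 4) / Kη * ε ^ n := by gcongr
      _ = η₁ * ε ^ n / 4 := by field_simp
  have hsmall_EL : CE * (M / Lq) ≤ η₁ * ε ^ n / 4 := by
    have h1 : CE * M ≤ KL * η₁ / 4 := by
      have h2 : 4 * CE * (M + 1) / η₁ ≤ KL := by rw [hKL]; nlinarith [sq_nonneg (4 * CE * (M ^ 2 + 1) / η₁)]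
      have h3 : 4 * CE * (M + 1) ≤ KL * η₁ := by rwa [div_le_iff₀ hη₁] at h2
      nlinarith
    calc CE * (M / Lq) ≤ CE * (M * ε ^ n / KL) := mul_le_mul_of_nonneg_left hML hCE.le
      _ = CE * M / KL * ε ^ n := by ring
      _ ≤ (KL * η₁ / 4) / KL * ε ^ n := by gcongr
      _ = η₁ * ε ^ n / 4 := by field_simp
  have hsmall_EL2 : CE * (M ^ 2 / ε * Lq ^ (-(1 / 2 : ℝ))) ≤ η₁ * ε ^ n / 4 := by
    set Q : ℝ := 4 * CE * (M ^ 2 + 1) / η₁ with hQ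
    have hQ0 : 0 < Q := by positivity
    have hKQ : Q ^ 2 ≤ KL := by rw [hKL]; have : 0 ≤ 4 * CE * (M + 1) / η₁ := (by positivity); linarith
    have hKLh : KL ^ (-(1 / 2 : ℝ)) ≤ Q⁻¹ := by
      have h1 : KL ^ (-(1 / 2 : ℝ)) ≤ (Q ^ 2) ^ (-(1 / 2 : ℝ)) := Real.rpow_le_rpow_of_nonpos (by positivity) hKQ (by norm_num)
      have h2 : (Q ^ 2) ^ (-(1 / 2 : ℝ)) = Q⁻¹ := by
        rw [← Real.rpow_natCast, ← Real.rpow_mul hQ0.le]; norm_num; exact Real.rpow_neg_one Q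
      rwa [h2] at h1
    calc CE * (M ^ 2 / ε * Lq ^ (-(1 / 2 : ℝ))) ≤ CE * (M ^ 2 * ε ^ n * KL ^ (-(1 / 2 : ℝ))) :=
          mul_le_mul_of_nonneg_left hML2 hCE.le
      _ ≤ CE * (M ^ 2 * ε ^ n * Q⁻¹) := by gcongr
      _ = CE * M ^ 2 / Q * ε ^ n := by ring
      _ ≤ η₁ / 4 * ε ^ n := by
          refine mul_le_mul_of_nonneg_right ?_ hεn0.le
          rw [div_le_iff₀ hQ0, hQ]
          have : η₁ / 4 * (4 * CE * (M ^ 2 + 1) / η₁) = CE * (M ^ 2 + 1) := by field_simp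
          rw [this]; nlinarith
      _ = η₁ * ε ^ n / 4 := by ring
  -- the reference
  refine ⟨R, fun t x => radialCutoff r (r + Lq) x • v (t - 1) x, u₀, hRge, ?_, hu₀s, hu₀d, hu₀c, ?_,
    continuousOn_cutRef hv hεpos r (r + Lq), fun t _ x => norm_cutRef_le r (r + Lq) t x,
    fun t _ x hx => cutRef_eq_zero_of_le hr0.le (by linarith) t (hRge.trans hx),
    fun t _ x hx => cutRef_eq_of_le hr0.le (by linarith) t hx, fun t _ => ?_, fun t ht x => ?_, fun b hb hbud => ?_⟩
  · -- `R ≤ K₂ ε^{−k₂} r²`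
    calc R = 2 * (ε⁻¹ * (r + KL * ε ^ (-(2 * n + 2))) ^ 2) := by rw [hR, hΛ, hLq]
      _ ≤ 4 * (1 + KL ^ 2) * ε ^ (-(4 * n + 5)) * (r * r) := radius_le hεpos hε1 hn hKL1 hr1
      _ ≤ K₂ * ε ^ (-(4 * n + 5)) * (r * r) := by gcongr
  · -- sup closeness of the datum: `V 0 x = χ x • v(−1) x`
    intro x
    have h01 : v (0 - 1) = v (-1) := by norm_num
    show ‖u₀ x - radialCutoff r (r + Lq) x • v (0 - 1) x‖ ≤ η₁ * ε ^ n
    rw [h01]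
    refine (hu₀sup x).trans ?_
    calc CD * ηc * (1 + Real.log r) = CD * ηq := by rw [hηc]; field_simp
      _ ≤ η₁ * ε ^ n / 4 := hsmall_D
      _ ≤ η₁ * ε ^ n := by linarith [mul_pos hη₁ hεn0]
  · -- `‖V t‖₃ ≤ ‖1_{B(0,R)} v(t−1)‖₃`
    refine (eLpNorm_cutRef_le hr0.le (by linarith) t).trans (eLpNorm_mono fun x => ?_)
    exact norm_indicator_le_of_subset (Metric.ball_subset_ball hRge) _ _
  · -- sup defect: module E needs SOME admissible `b`; the localised slices are bounded by `(M/√ε)|B_R|^{1/3}`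
    obtain ⟨b, hb, hbud⟩ : ∃ b : ℝ, 0 ≤ b ∧ ∀ s ∈ Set.Icc (-1 : ℝ) (-ε),
        eLpNorm ((Metric.ball (0 : EuclideanSpace ℝ (Fin 3)) (2 * (Λ * (r + Lq) ^ 2))).indicator (v s)) 3 volume ≤ ENNReal.ofReal b := by
      -- `‖1_{B_R} v(s)‖₃ ≤ (M/√ε)·|B_R|^{1/3}` uniformly for `s ∈ [−1,−ε]`
      set bR : ℝ := M / Real.sqrt ε * ((volume (Metric.ball (0 : EuclideanSpace ℝ (Fin 3)) (2 * (Λ * (r + Lq) ^ 2)))) ^ (1 / (3 : ℝ))).toReal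
        with hbR
      refine ⟨bR, by positivity, fun s hs => ?_⟩
      have hs0 : s < 0 := by linarith [hs.2]
      have hvs : ∀ y, ‖(Metric.ball (0 : EuclideanSpace ℝ (Fin 3)) (2 * (Λ * (r + Lq) ^ 2))).indicator (v s) y‖ ≤
          ‖(Metric.ball (0 : EuclideanSpace ℝ (Fin 3)) (2 * (Λ * (r + Lq) ^ 2))).indicator (fun _ => M / Real.sqrt ε) y‖ := by
        intro y
        by_cases hy : y ∈ Metric.ball (0 : EuclideanSpace ℝ (Fin 3)) (2 * (Λ * (r + Lq) ^ 2))
        · rw [Set.indicator_of_mem hy, Set.indicator_of_mem hy, Real.norm_of_nonneg (by positivity)]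
          refine (hv.norm_le hs0 y).trans (div_le_div_of_nonneg_left hM (Real.sqrt_pos.2 hεpos) (Real.sqrt_le_sqrt (by linarith [hs.2])))
        · rw [Set.indicator_of_notMem hy, Set.indicator_of_notMem hy]; simp
      refine (eLpNorm_mono hvs).trans ?_
      rw [eLpNorm_indicator_const measurableSet_ball (by norm_num) (by norm_num), Real.enorm_eq_ofReal (by positivity), hbR,
        ENNReal.ofReal_mul (by positivity), ENNReal.ofReal_toReal (ENNReal.rpow_ne_top_of_nonneg (by norm_num) measure_ball_lt_top.ne)]
      norm_num
    have h := (hdef b hb hquiet hbud t ht).1 x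
    refine h.trans ?_
    have hηc2 : CE * ηc ^ 2 ≤ η₁ * ε ^ n / 4 := by
      have : ηc ^ 2 ≤ ηq := by
        calc ηc ^ 2 ≤ ηc * 1 := by rw [sq]; exact mul_le_mul_of_nonneg_left (hηcq.trans hηq1) hηc0
          _ = ηc := mul_one _
          _ ≤ ηq := hηcq
      exact (mul_le_mul_of_nonneg_left this hCE.le).trans hsmall_Eη
    calc CE * (M / Lq + M ^ 2 / ε * Lq ^ (-(1 / 2 : ℝ)) + ηc ^ 2)
        = CE * (M / Lq) + CE * (M ^ 2 / ε * Lq ^ (-(1 / 2 : ℝ))) + CE * ηc ^ 2 := by ring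
      _ ≤ η₁ * ε ^ n / 4 + η₁ * ε ^ n / 4 + η₁ * ε ^ n / 4 := add_le_add (add_le_add hsmall_EL hsmall_EL2) hηc2
      _ ≤ η₁ * ε ^ n := by linarith [mul_pos hη₁ hεn0]
  · -- the `L³` clauses
    have hbud' : ∀ s ∈ Set.Icc (-1 : ℝ) (-ε),
        eLpNorm ((Metric.ball (0 : EuclideanSpace ℝ (Fin 3)) (2 * (Λ * (r + Lq) ^ 2))).indicator (v s)) 3 volume ≤ ENNReal.ofReal b :=
      fun s hs => by rw [← hR]; exact hbud s hs
    refine ⟨?_, fun t ht => ?_⟩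
    · -- datum
      have h01 : v (0 - 1) = v (-1) := by norm_num
      have hfun : (fun x => u₀ x - radialCutoff r (r + Lq) x • v (0 - 1) x) = fun x => u₀ x - radialCutoff r (r + Lq) x • v (-1) x := by
        rw [h01]
      show eLpNorm (fun x => u₀ x - radialCutoff r (r + Lq) x • v (0 - 1) x) 3 volume ≤ ENNReal.ofReal (K₂ * (b + 1))
      rw [hfun]
      refine hu₀L3.trans ?_
      have h1 : eLpNorm ((Metric.ball (0 : EuclideanSpace ℝ (Fin 3)) (r + Lq)).indicator (v (-1))) 3 volume ≤ ENNReal.ofReal b := by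
        refine le_trans (eLpNorm_mono fun x => ?_) (hbud (-1) ⟨le_rfl, by linarith [hε.2]⟩)
        exact norm_indicator_le_of_subset (Metric.ball_subset_ball hRge) _ _
      have hCR : (CR : ℝ≥0∞) = ENNReal.ofReal (CR : ℝ) := (ENNReal.ofReal_coe_nnreal).symm
      calc (CR : ℝ≥0∞) * eLpNorm ((Metric.ball (0 : EuclideanSpace ℝ (Fin 3)) (r + Lq)).indicator (v (-1))) 3 volume + ENNReal.ofReal (CD * ηc)
          ≤ ENNReal.ofReal (CR : ℝ) * ENNReal.ofReal b + ENNReal.ofReal (CD * 1) := by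
            rw [hCR]; gcongr; exact hηcq.trans hηq1
        _ = ENNReal.ofReal ((CR : ℝ) * b + CD) := by
            rw [← ENNReal.ofReal_mul hCR0, mul_one, ← ENNReal.ofReal_add (by positivity) hCD.le]
        _ ≤ ENNReal.ofReal (K₂ * (b + 1)) := by
            refine ENNReal.ofReal_le_ofReal ?_
            nlinarith [hK₂D, hb, hCR0, hCD.le, hK₂1]
    · -- defect
      refine (hdef b hb hquiet hbud' t ht).2.trans (ENNReal.ofReal_le_ofReal ?_)
      have hεΛ : ε * Λ = 1 := by rw [hΛ]; exact mul_inv_cancel₀ hεpos.ne'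
      rw [hεΛ, div_one]
      have hηcb : ηc * b ≤ 1 * b := mul_le_mul_of_nonneg_right (hηcq.trans hηq1) hb
      nlinarith [hK₂E, hb, hM, hCE.le, mul_nonneg hCE.le hb, mul_nonneg (mul_nonneg hCE.le hM) hb, hK₂1]

end Summit.NavierStokesRegularity.NavierStokesRegularity.Cruxes.TypeIQuantSubcubicExp.QuietCollar

end
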